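import Mathlib
import Summits.KontsevichZagierPeriods.KontsevichZagierPeriods.Theorems.TorsionLogsNeronTorsionSectorStubGridDataAux
import HarnessLib

/-!
# Stub `stub_gridData` — crux `TorsionLogs.NeronTorsionSector`, line `registered` (block U6), II:
# consequences of the real Weierstrass dictionary

Auxiliary file for `TorsionLogsNeronTorsionSectorStubGridData.lean`. Throughout, `hD` is the
conclusion of the landed dictionary `stub_realDictionary` (verbatim): `ω > 0` the real period,
`X = ℘|ℝ`, `Y = ℘′|ℝ` of the real curve `y² = f(x) = 4x³ − g₂x − g₃`. We derive:

* `gridData_regular_chord` — the chord law with the REGULAR slope `M(x)/(y + y₁)`,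
  `M(x) = 4x² + 4xx₁ + 4x₁² − g₂` (`= (y − y₁)/(x − x₁)` off the diagonal, and the tangent slope
  `f′(x₁)/(2y₁)` on it), valid whenever `y + y₁ ≠ 0`;
* `gridData_alg_add`, `gridData_alg_multiples`, `gridData_alg_half` — the points `u` with
  `X u, Y u` algebraic are closed under addition (chord/duplication formulas are rational over
  `ℚ(g₂)`), hence contain the multiples of such a point, and are closed under halving inside
  `(0, ω/2)` (the duplication formula makes `X(v)` a root of the monic quartic
  `T⁴ − 4cT³ + (g₂/2)T² + (cg₂ + 2g₃)T + cg₃ + g₂²/16`, `c = X(2v)`);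
* `gridData_X_natMod` — reduction of grid arguments modulo the period; `gridData_sqrt_eq_neg` —
  `√f(X u) = −Y u` on the lower branch;
* `gridData_tau_X`, `gridData_tau'_X` — the lower/upper-branch translations by `P₁ = (X d, Y d)`
  in regular chord form are `X(u) ↦ X(u + d)` resp. `X(u) ↦ X(u − d)` in the parameter.

References: D. F. Lawden, *Elliptic Functions and Applications* (1989), §6.7–6.8, §6.11;
J. H. Silverman, *The Arithmetic of Elliptic Curves* (2009), III.2.3.
-/

noncomputable section

-- `Summit.KontsevichZagierPeriods.KontsevichZagierPeriods.…` is the tree's mandated layout (single-conjunct summit).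
set_option linter.dupNamespace false

open Set

namespace Summit.KontsevichZagierPeriods.KontsevichZagierPeriods.Cruxes.NeronTorsionSector.Translation

/-- On the lower branch `y = Y u ≤ 0` with `y² = f(x)`: `√f(x) = −y`. [folklore] -/
theorem gridData_sqrt_eq_neg : ∀ {a b : ℝ}, a ≤ 0 → a ^ 2 = b → Real.sqrt b = -a := by
  intro a b ha hab
  rw [← hab, Real.sqrt_sq_eq_abs, abs_of_nonpos ha]

section Dictionary

variable {g₂ g₃ e₁ ω : ℝ} {f X Y : ℝ → ℝ}
  (hf : ∀ x, f x = 4 * x ^ 3 - g₂ * x - g₃)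
  (hD : 0 < ω ∧
      ω = 2 * ∫ x in Set.Ioi e₁, (Real.sqrt (f x))⁻¹ ∧
      (∀ u, X (u + ω) = X u) ∧ (∀ u, X (-u) = X u) ∧ (∀ u, Y (u + ω) = Y u) ∧ (∀ u, Y (-u) = -Y u) ∧
      X (ω / 2) = e₁ ∧ Y (ω / 2) = 0 ∧
      (∀ u ∈ Set.Ioo 0 ω, u ≠ ω / 2 → e₁ < X u) ∧
      (∀ u ∈ Set.Ioo 0 ω, Y u ^ 2 = f (X u)) ∧
      (∀ u ∈ Set.Ioo 0 (ω / 2), Y u < 0) ∧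
      StrictAntiOn X (Set.Ioc 0 (ω / 2)) ∧
      (∀ x, e₁ < x → ∃ u ∈ Set.Ioo 0 (ω / 2), X u = x) ∧
      (∀ u ∈ Set.Ioc 0 (ω / 2), ∫ x in Set.Ioi (X u), (Real.sqrt (f x))⁻¹ = u) ∧
      (∀ u ∈ Set.Ioo 0 ω, HasDerivAt X (Y u) u ∧ HasDerivAt Y (6 * X u ^ 2 - g₂ / 2) u) ∧
      (∀ u ∈ Set.Ioo 0 ω, ∀ v ∈ Set.Ioo 0 ω, u + v ≠ ω → X u ≠ X v →
        X (u + v) = ((Y u - Y v) / (X u - X v)) ^ 2 / 4 - X u - X v ∧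
        Y (u + v) = -(Y u + (Y u - Y v) / (X u - X v) * (X (u + v) - X u))) ∧
      (∀ u ∈ Set.Ioo 0 ω, u ≠ ω / 2 →
        X (2 * u) = ((6 * X u ^ 2 - g₂ / 2) / Y u) ^ 2 / 4 - 2 * X u ∧
        Y (2 * u) = -(Y u + (6 * X u ^ 2 - g₂ / 2) / Y u * (X (2 * u) - X u))) ∧
      (∀ u ∈ Set.Ioo 0 ω, ∀ v ∈ Set.Ioo 0 ω, X u = X v ↔ (u = v ∨ u + v = ω)))

/-! ### The chord law in regular form -/

include hf hD in
/-- **Regular chord law.** For `u ∈ (0, ω)`, `d ∈ (0, ω/2)`, `u + d ≠ ω` and `Y u + Y d ≠ 0`: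
`X(u + d) = (M/(Y u + Y d))²/4 − X u − X d` and `Y(u + d) = −(Y u + M/(Y u + Y d)·(X(u + d) − X u))`
with `M = 4(X u)² + 4(X u)(X d) + 4(X d)² − g₂`. Off the diagonal this is the chord law with the
slope rewritten through `(Y u − Y d)(Y u + Y d) = f(X u) − f(X d) = (X u − X d)·M`; on the diagonal
(`u = d`) it is the duplication formula (`M = 12(X d)² − g₂`, slope `f′/(2Y)`).
[cite: SilvermanAEC2009, III.2.3] -/
theorem gridData_regular_chord {u d : ℝ} (hu : u ∈ Ioo 0 ω) (hd : d ∈ Ioo 0 (ω / 2))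
    (hud : u + d ≠ ω) (hY : Y u + Y d ≠ 0) :
    X (u + d) =
      ((4 * X u ^ 2 + 4 * X u * X d + 4 * X d ^ 2 - g₂) / (Y u + Y d)) ^ 2 / 4 - X u - X d ∧
    Y (u + d) = -(Y u + (4 * X u ^ 2 + 4 * X u * X d + 4 * X d ^ 2 - g₂) / (Y u + Y d) *
      (X (u + d) - X u)) := by
  obtain ⟨hω, -, -, -, -, -, -, -, -, hYsq, hYneg, -, -, -, -, hadd, hdup, hiff⟩ := hD
  have hdω : d ∈ Ioo 0 ω := ⟨hd.1, by linarith [hd.2]⟩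
  by_cases hX : X u = X d
  · -- on the diagonal: duplication
    have hud' : u = d := ((hiff u hu d hdω).1 hX).resolve_right hud
    subst hud'
    have hne : u ≠ ω / 2 := fun h => hud (by linarith)
    have hY0 : Y u ≠ 0 := (hYneg u hd).ne
    obtain ⟨hx2, hy2⟩ := hdup u hu hne
    have hslope : (4 * X u ^ 2 + 4 * X u * X u + 4 * X u ^ 2 - g₂) / (Y u + Y u) =
        (6 * X u ^ 2 - g₂ / 2) / Y u := by
      field_simp
      ring
    rw [← two_mul, hslope]
    exact ⟨hx2.trans (by ring), hy2⟩
  · obtain ⟨hx, hy⟩ := hadd u hu d hdω hud hX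
    have hslope : (Y u - Y d) / (X u - X d) =
        (4 * X u ^ 2 + 4 * X u * X d + 4 * X d ^ 2 - g₂) / (Y u + Y d) := by
      rw [div_eq_div_iff (sub_ne_zero.2 hX) hY]
      have h1 := hYsq u hu
      have h2 := hYsq d hdω
      rw [hf] at h1 h2
      linear_combination h1 - h2
    rw [hslope] at hx hy
    exact ⟨hx, hy⟩

/-! ### Algebraic points -/

include hD in
/-- **Algebraic points are closed under addition.** If `X u, Y u, X v, Y v` (and `g₂`) are
algebraic, `u, v ∈ (0, ω)`, `u + v ≠ ω`, then `X(u + v), Y(u + v)` are algebraic: by the chord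
law if `X u ≠ X v`, by the duplication formula if `u = v`. [cite: SilvermanAEC2009, III.2.3] -/
theorem gridData_alg_add (hg₂ : IsAlgebraic ℚ g₂) {u v : ℝ} (hu : u ∈ Ioo 0 ω) (hv : v ∈ Ioo 0 ω)
    (huv : u + v ≠ ω) (hXu : IsAlgebraic ℚ (X u)) (hYu : IsAlgebraic ℚ (Y u))
    (hXv : IsAlgebraic ℚ (X v)) (hYv : IsAlgebraic ℚ (Y v)) :
    IsAlgebraic ℚ (X (u + v)) ∧ IsAlgebraic ℚ (Y (u + v)) := by
  obtain ⟨hω, -, -, -, -, -, -, -, -, -, -, -, -, -, -, hadd, hdup, hiff⟩ := hD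
  rw [← mem_algebraicClosure_iff] at hg₂ hXu hYu hXv hYv ⊢
  rw [← mem_algebraicClosure_iff]
  by_cases hX : X u = X v
  · have huv' : u = v := ((hiff u hu v hv).1 hX).resolve_right huv
    subst huv'
    have hne : u ≠ ω / 2 := fun h => huv (by linarith)
    obtain ⟨hx2, hy2⟩ := hdup u hu hne
    rw [← two_mul]
    have hx2' : X (2 * u) ∈ algebraicClosure ℚ ℝ := by
      rw [hx2]
      apply_rules only [hg₂, hXu, hYu, add_mem, sub_mem, neg_mem, pow_mem, div_mem, inv_mem,
        mul_mem, ofNat_mem, one_mem, zero_mem]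
    refine ⟨hx2', ?_⟩
    rw [hy2]
    apply_rules only [hg₂, hXu, hYu, hx2', add_mem, sub_mem, neg_mem, pow_mem, div_mem, inv_mem,
      mul_mem, ofNat_mem, one_mem, zero_mem]
  · obtain ⟨hx, hy⟩ := hadd u hu v hv huv hX
    have hx' : X (u + v) ∈ algebraicClosure ℚ ℝ := by
      rw [hx]
      apply_rules only [hXu, hYu, hXv, hYv, add_mem, sub_mem, neg_mem, pow_mem, div_mem, inv_mem,
        mul_mem, ofNat_mem, one_mem, zero_mem]
    refine ⟨hx', ?_⟩
    rw [hy]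
    apply_rules only [hXu, hYu, hXv, hYv, hx', add_mem, sub_mem, neg_mem, pow_mem, div_mem,
      inv_mem, mul_mem, ofNat_mem, one_mem, zero_mem]

include hD in
/-- Reduction modulo the period of grid arguments: `X(c·ω/K) = X((c mod K)·ω/K)`, and the same for
`Y` (`ω`-periodicity). [folklore] -/
theorem gridData_X_natMod {K : ℕ} (hK : 0 < K) (c : ℕ) :
    X (((c % K : ℕ) : ℝ) * (ω / K)) = X ((c : ℝ) * (ω / K)) ∧
    Y (((c % K : ℕ) : ℝ) * (ω / K)) = Y ((c : ℝ) * (ω / K)) := by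
  have hXper : Function.Periodic X ω := hD.2.2.1
  have hYper : Function.Periodic Y ω := hD.2.2.2.2.1
  have hKr : (K : ℝ) ≠ 0 := by positivity
  have e : (c : ℝ) * (ω / K) = ((c % K : ℕ) : ℝ) * (ω / K) + ((c / K : ℕ) : ℝ) * ω := by
    have h' : (c : ℝ) = (K : ℝ) * ((c / K : ℕ) : ℝ) + ((c % K : ℕ) : ℝ) := by
      exact_mod_cast (Nat.div_add_mod c K).symm
    rw [h']
    field_simp
    ring
  rw [e, hXper.nat_mul, hYper.nat_mul]
  exact ⟨rfl, rfl⟩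

include hD in
/-- **Multiples of an algebraic point are algebraic.** If `P = p·ω/K` (`0 < p < K`, `p, K` coprime)
has algebraic coordinates then so do all `j·P`, `1 ≤ j < K` (written with the argument reduced
modulo `ω`): induction on `j` with `gridData_alg_add`; `j·P ∉ ωℤ` because `K ∤ jp`.
[cite: SilvermanAEC2009, III.2.3] -/
theorem gridData_alg_multiples (hg₂ : IsAlgebraic ℚ g₂) {K p : ℕ} (hp : 0 < p) (hpK : p < K)
    (hcop : Nat.Coprime p K) (hXp : IsAlgebraic ℚ (X ((p : ℝ) * (ω / K))))
    (hYp : IsAlgebraic ℚ (Y ((p : ℝ) * (ω / K)))) :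
    ∀ j : ℕ, 1 ≤ j → j < K →
      IsAlgebraic ℚ (X (((p * j % K : ℕ) : ℝ) * (ω / K))) ∧
      IsAlgebraic ℚ (Y (((p * j % K : ℕ) : ℝ) * (ω / K))) := by
  have hω : 0 < ω := hD.1
  have hK : 0 < K := lt_of_le_of_lt (Nat.zero_le p) hpK
  have hKr : (0 : ℝ) < K := by exact_mod_cast hK
  have hωK : 0 < ω / K := div_pos hω hKr
  -- `K ∤ p j` for `1 ≤ j < K`
  have hmod : ∀ j : ℕ, 1 ≤ j → j < K → 0 < p * j % K := by
    intro j hj hjK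
    refine Nat.pos_of_ne_zero fun h0 => ?_
    have hdvd : K ∣ j := hcop.symm.dvd_of_dvd_mul_left (Nat.dvd_of_mod_eq_zero h0)
    exact absurd (Nat.le_of_dvd hj hdvd) (not_le.2 hjK)
  -- a reduced grid argument lies in `(0, ω)`
  have hIoo : ∀ r : ℕ, 0 < r → r < K → ((r : ℝ) * (ω / K)) ∈ Ioo 0 ω := by
    intro r hr hrK
    refine ⟨mul_pos (by exact_mod_cast hr) hωK, ?_⟩
    have hrK' : (r : ℝ) < K := by exact_mod_cast hrK
    calc (r : ℝ) * (ω / K) < K * (ω / K) := mul_lt_mul_of_pos_right hrK' hωK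
      _ = ω := by field_simp
  intro j hj hjK
  induction j with
  | zero => exact absurd hj (by norm_num)
  | succ j ih =>
    rcases Nat.eq_zero_or_pos j with rfl | hjpos
    · rw [zero_add, mul_one, Nat.mod_eq_of_lt hpK]
      exact ⟨hXp, hYp⟩
    · obtain ⟨ihX, ihY⟩ := ih hjpos (by omega)
      set r : ℕ := p * j % K with hr
      have hr0 : 0 < r := hmod j hjpos (by omega)
      have hrK : r < K := Nat.mod_lt _ hK
      have hu := hIoo r hr0 hrK
      have hv := hIoo p hp hpK
      have hsum : ((r : ℝ) * (ω / K)) + (p : ℝ) * (ω / K) = ((r + p : ℕ) : ℝ) * (ω / K) := by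
        push_cast
        ring
      have hmod' : (r + p) % K = p * (j + 1) % K := by
        rw [hr, Nat.mod_add_mod, mul_add, mul_one]
      have hne : ((r : ℝ) * (ω / K)) + (p : ℝ) * (ω / K) ≠ ω := by
        rw [hsum]
        intro h
        have h' : ((r + p : ℕ) : ℝ) * (ω / K) = (K : ℝ) * (ω / K) := by rw [h]; field_simp
        have h'' : ((r + p : ℕ) : ℝ) = K := mul_right_cancel₀ hωK.ne' h'
        have hrp : r + p = K := by exact_mod_cast h''
        have h0 : p * (j + 1) % K = 0 := by rw [← hmod', hrp, Nat.mod_self]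
        exact absurd h0 (hmod (j + 1) hj hjK).ne'
      have halg := gridData_alg_add hD hg₂ hu hv hne ihX ihY hXp hYp
      rw [hsum, ← (gridData_X_natMod hD hK (r + p)).1, ← (gridData_X_natMod hD hK (r + p)).2,
        hmod'] at halg
      exact halg

include hf hD in
/-- **Halving an algebraic point.** For `v ∈ (0, ω/2)`: if `X(2v)` (and `g₂, g₃`) are algebraic
then `X v, Y v` are algebraic. From the duplication formula `X(2v) = ((6X² − g₂/2)/Y)²/4 − 2X`
and `Y² = f(X)`, `T = X v` is a root of the monic quartic
`T⁴ − 4cT³ + (g₂/2)T² + (cg₂ + 2g₃)T + (cg₃ + g₂²/16)`, `c = X(2v)`; then `Y v = −√f(X v)`.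
[cite: SilvermanAEC2009, III.2.3] -/
theorem gridData_alg_half (hg₂ : IsAlgebraic ℚ g₂) (hg₃ : IsAlgebraic ℚ g₃) {v : ℝ}
    (hv : v ∈ Ioo 0 (ω / 2)) (h2 : IsAlgebraic ℚ (X (2 * v))) :
    IsAlgebraic ℚ (X v) ∧ IsAlgebraic ℚ (Y v) := by
  obtain ⟨hω, -, -, -, -, -, -, -, -, hYsq, hYneg, -, -, -, -, -, hdup, -⟩ := hD
  have hvω : v ∈ Ioo 0 ω := ⟨hv.1, by linarith [hv.2]⟩
  have hne : v ≠ ω / 2 := hv.2.ne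
  have hY0 : Y v ≠ 0 := (hYneg v hv).ne
  have hsq := hYsq v hvω
  rw [hf] at hsq
  obtain ⟨hx2, -⟩ := hdup v hvω hne
  have key : X v ^ 4 + (-4 * X (2 * v)) * X v ^ 3 + (g₂ / 2) * X v ^ 2 +
      (X (2 * v) * g₂ + 2 * g₃) * X v + (X (2 * v) * g₃ + g₂ ^ 2 / 16) = 0 := by
    have h1 : 4 * (X (2 * v) + 2 * X v) * Y v ^ 2 = (6 * X v ^ 2 - g₂ / 2) ^ 2 := by
      rw [hx2]
      field_simp
      ring
    rw [hsq] at h1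
    linear_combination (-1 / 4 : ℝ) * h1
  rw [← mem_algebraicClosure_iff] at hg₂ hg₃ h2
  have hXv : IsAlgebraic ℚ (X v) := by
    refine gridData_isAlgebraic_of_quartic ?_ ?_ ?_ ?_ key <;> rw [← mem_algebraicClosure_iff] <;>
      apply_rules only [hg₂, hg₃, h2, add_mem, sub_mem, neg_mem, pow_mem, div_mem, inv_mem, mul_mem,
        ofNat_mem, one_mem, zero_mem]
  refine ⟨hXv, IsAlgebraic.of_pow two_pos ?_⟩
  rw [← mem_algebraicClosure_iff] at hXv ⊢
  rw [hsq]
  apply_rules only [hg₂, hg₃, hXv, add_mem, sub_mem, neg_mem, pow_mem, div_mem, inv_mem, mul_mem,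
    ofNat_mem, one_mem, zero_mem]

/-! ### The translations in the parameter -/

include hf hD in
/-- **The lower-branch translation is `u ↦ u + d`.** For `d ∈ (0, ω/2)` and the regular-form
translation `τ(t) = (M(t)/(−√f(t) + Y d))²/4 − t − X d` by `P₁ = (X d, Y d)`:
`τ(X u) = X(u + d)` for every `u ∈ (0, ω/2]` (there `−√f(X u) = Y u ≤ 0` and `Y u + Y d < 0`).
[cite: Lawden1989, §6.8] -/
theorem gridData_tau_X {d : ℝ} (hd : d ∈ Ioo 0 (ω / 2)) {τ : ℝ → ℝ}
    (hτ : τ = fun t => ((4 * t ^ 2 + 4 * t * X d + 4 * X d ^ 2 - g₂) /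
      (-Real.sqrt (f t) + Y d)) ^ 2 / 4 - t - X d)
    {u : ℝ} (hu : u ∈ Ioc 0 (ω / 2)) : τ (X u) = X (u + d) := by
  obtain ⟨hω, -, -, -, -, -, hXh, hYh, -, hYsq, hYneg, -, -, -, -, -, -, -⟩ := id hD
  have huω : u ∈ Ioo 0 ω := ⟨hu.1, by linarith [hu.2]⟩
  have hYu : Y u ≤ 0 := by
    rcases hu.2.lt_or_eq with h | h
    · exact (hYneg u ⟨hu.1, h⟩).le
    · rw [h, hYh]
  have hsqrt : Real.sqrt (f (X u)) = -Y u := gridData_sqrt_eq_neg hYu (hYsq u huω)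
  have hYd : Y d < 0 := hYneg d hd
  have hne : Y u + Y d ≠ 0 := by linarith
  have hud : u + d ≠ ω := by linarith [hu.2, hd.2]
  obtain ⟨hx, -⟩ := gridData_regular_chord hf hD huω hd hud hne
  rw [hx, hτ]
  simp only [hsqrt, neg_neg]

include hf hD in
/-- **The upper-branch translation is `u ↦ u − d`.** For `d ∈ (0, ω/2)` and the regular-form
translation `τ⁺(t) = (M(t)/(√f(t) + Y d))²/4 − t − X d` by `P₁ = (X d, Y d)` applied to the
upper point `(t, +√f(t)) = (X(ω − u), Y(ω − u))`: `τ⁺(X u) = X(u − d)` for `u ∈ (d, ω/2]` whenever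
`√f(X u) + Y d ≠ 0`. [cite: Lawden1989, §6.8] -/
theorem gridData_tau'_X {d : ℝ} (hd : d ∈ Ioo 0 (ω / 2)) {τ' : ℝ → ℝ}
    (hτ' : τ' = fun t => ((4 * t ^ 2 + 4 * t * X d + 4 * X d ^ 2 - g₂) /
      (Real.sqrt (f t) + Y d)) ^ 2 / 4 - t - X d)
    {u : ℝ} (hu : u ∈ Ioc d (ω / 2)) (hne : Real.sqrt (f (X u)) + Y d ≠ 0) :
    τ' (X u) = X (u - d) := by
  obtain ⟨hω, -, hXper, hXev, hYper, hYodd, hXh, hYh, -, hYsq, hYneg, -, -, -, -, -, -, -⟩ := id hD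
  have hu0 : 0 < u := hd.1.trans hu.1
  have huω : u ∈ Ioo 0 ω := ⟨hu0, by linarith [hu.2]⟩
  have hU : ω - u ∈ Ioo 0 ω := ⟨by linarith [hu.2], by linarith⟩
  have hYu : Y u ≤ 0 := by
    rcases hu.2.lt_or_eq with h | h
    · exact (hYneg u ⟨hu0, h⟩).le
    · rw [h, hYh]
  have hsqrt : Real.sqrt (f (X u)) = -Y u := gridData_sqrt_eq_neg hYu (hYsq u huω)
  have hXU : X (ω - u) = X u := by rw [sub_eq_neg_add, hXper, hXev]
  have hYU : Y (ω - u) = -Y u := by rw [sub_eq_neg_add, hYper, hYodd]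
  have hUd : ω - u + d ≠ ω := by
    intro h
    linarith [hu.1]
  have hne' : Y (ω - u) + Y d ≠ 0 := by rwa [hYU, ← hsqrt]
  obtain ⟨hx, -⟩ := gridData_regular_chord hf hD hU hd hUd hne'
  rw [hXU, hYU, ← hsqrt] at hx
  have e : X (ω - u + d) = X (u - d) := by
    rw [show ω - u + d = -(u - d) + ω by ring, hXper, hXev]
  rw [← e, hx, hτ']

end Dictionary

end Summit.KontsevichZagierPeriods.KontsevichZagierPeriods.Cruxes.NeronTorsionSector.Translation
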